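import Summits.QuantumAdvantage.QuantumAdvantage.Theorems.CubicForrelationNearExactIsExactTwelveZ512H4

/-!
# Crux `CubicForrelation.NearExactIsExact` (stmt-QuantumAdvantage-14043) — n = 12, level-`≥ 6` side with a 9-flat even set on the OPEN
  window: the perturbation `π = e − σ·1_Z` has energy `Σ π² ≤ 507` — WHATEVER THE PARTNER

Certificate seat `b2b-cforr-cert` (gen 27).  HONEST FRAMING: a finite-slice lemma (standard axioms) about cubic Boolean pairs on 12 bits; the
partner-free half of "no level-`≥ 6` side on the open window `57/64 < Φ < 29/32`" (the partner-specific Parseval lower bounds come next).  NO value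
of `θ₁₂` is claimed; NOT summit progress.

Setting.  Cubic `f, g`, `W_g = 64u''`, `e := u'' − (−1)^f`, `Z := {u'' even} = x_Z ⊕ V₀` a 9-flat, `57/64 < Φ` (so `B := Σe² ≤ 895`, off-flat
energy `E_off ≤ 383`), `σ = (−1)^{hb}` the mod-4 sign of `e` on `Z` (AFFINE along `V₀`), `S := σ·1_Z`, `π := e − S` (`= 4λ` on `Z`, `= e` off `Z`),
`L := {x ∈ Z : λ odd}`.

THE BOUND `tzc_pi_sq_le`: `Σ_x π(x)² ≤ 507`.  Proof.  The cost `c := e² − 1_Z` has `Σ c = B − 512 ≤ 380` (`≡ 0 mod 4` and `< 384`).  Suppose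
`Σ π² ≥ 508`.  By `tzc_A2_energy` either `E_off ≥ 256` or `4 ∣ e` off `Z`.
* `E_off ≥ 256`: pointwise `π² ≤ 2c` on `Z` (`tzc_pw_two`), so `Σ_Z c ≥ Σ_Z π² − Σ_Z c ≥ (508 − E_off) − (380 − E_off) = 128`, while
  `Σ_Z c ≤ 380 − 256 = 124`.
* `4 ∣ e` off `Z`: by `tzc_L_card`, `#L ≥ 64` (each point costs `c ≥ 8`, `tzc_pw_L`: total `≥ 512 > 380`) or `L = ∅`; then `8 ∣ e − σ` on `Z`,
  pointwise `3π² ≤ 4c` on `Z` (`tzc_pw_three`), so `4·380 ≥ 4Σc ≥ 3Σ_Zπ² + 4E_off ≥ 3·508 = 1524`.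
What it is for: with the duality `ê = −64e′`, `π̂ = −64e′ − Ŝ` and Parseval, a partner whose residual is forced to be large in `ℓ²` away from the
8 frequencies of `Ŝ` (type O: `|τ| ≥ 1` everywhere and `≥ 3` on `≥ 512` points; level 5: odd on a hyperplane) contradicts `Σπ² ≤ 507`.

References: MacWilliams–Sloane (1977) Ch. 13–15; R. O'Donnell (2014) §1.4, §3.3.  Axioms: the standard three.
-/

set_option linter.dupNamespace false -- D-0017: single-problem summit ⇒ `QuantumAdvantage.QuantumAdvantage` by design

noncomputable section

namespace Summit.QuantumAdvantage.QuantumAdvantage.Theorems.CubicForrelation.NearExactIsExact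

open Finset
open Literature.Computability.QuantumComplexity
open Literature.Computability.QuantumComplexity.BuzetChailloux (bxor zeroVec bxor_bxor_cancel_left bxor_zeroVec zeroVec_bxor bxor_comm
  bxor_self)
open Literature.Computability.QuantumComplexity.DerivativeWalsh (W)

/-! ### Pointwise arithmetic for the bound -/

/-- `k(k + 1) ≥ 0` for integers. [folklore] -/
theorem tzc_kk_succ (k : ℤ) : 0 ≤ k * (k + 1) := by
  rcases le_or_gt 0 k with h | h
  · exact mul_nonneg h (by linarith)
  · exact mul_nonneg_of_nonpos_of_nonpos (by omega) (by omega)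

/-- `k(k − 1) ≥ 0` for integers. [folklore] -/
theorem tzc_kk_pred (k : ℤ) : 0 ≤ k * (k - 1) := by
  rcases le_or_gt 1 k with h | h
  · exact mul_nonneg (by linarith) (by linarith)
  · exact mul_nonneg_of_nonpos_of_nonpos (by omega) (by omega)

/-- On `Z`: `σ = ±1`, `4 ∣ e − σ` ⇒ `(e − σ)² ≤ 2(e² − 1)`. [folklore] -/
theorem tzc_pw_two {e σ : ℤ} (hσ : σ = 1 ∨ σ = -1) (h4 : (4 : ℤ) ∣ e - σ) : (e - σ) ^ 2 ≤ 2 * (e ^ 2 - 1) := by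
  obtain ⟨k, hk⟩ := h4
  have he : e = σ + 4 * k := by linarith
  subst he
  rcases hσ with rfl | rfl
  · nlinarith [tzc_kk_succ k]
  · nlinarith [tzc_kk_pred k]

/-- On `Z`: `σ = ±1`, `8 ∣ e − σ` ⇒ `3(e − σ)² ≤ 4(e² − 1)`. [folklore] -/
theorem tzc_pw_three {e σ : ℤ} (hσ : σ = 1 ∨ σ = -1) (h8 : (8 : ℤ) ∣ e - σ) : 3 * (e - σ) ^ 2 ≤ 4 * (e ^ 2 - 1) := by
  obtain ⟨k, hk⟩ := h8
  have he : e = σ + 8 * k := by linarith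
  subst he
  rcases hσ with rfl | rfl
  · nlinarith [tzc_kk_succ k]
  · nlinarith [tzc_kk_pred k]

/-- On `Z`: `σ = ±1`, `4 ∣ e − σ`, `(e − σ)/4` odd ⇒ `8 ≤ e² − 1`. [folklore] -/
theorem tzc_pw_L {e σ : ℤ} (hσ : σ = 1 ∨ σ = -1) (h4 : (4 : ℤ) ∣ e - σ) (hodd : Odd ((e - σ) / 4)) : 8 ≤ e ^ 2 - 1 := by
  obtain ⟨k, hk⟩ := h4
  have hk4 : (e - σ) / 4 = k := by rw [hk]; omega
  rw [hk4] at hodd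
  have ho := Int.odd_iff.1 hodd
  have he : e = σ + 4 * k := by linarith
  subst he
  have : σ + 4 * k ≤ -3 ∨ 3 ≤ σ + 4 * k := by rcases hσ with rfl | rfl <;> omega
  have := tp_sq_ge (k := 3) (by norm_num) this
  linarith

/-! ### The bound `Σ π² ≤ 507` -/

/-- **The perturbation energy bound, partner-free.**  Cubic `f, g` on 12 bits, `W_g = 64u''`, `Z = {u'' even} = x_Z ⊕ V₀` a 9-flat,
`57/64 < Φ(f,g)`, `σ = sZ [e ≡ 3 (mod 4)]` the mod-4 sign of `e = u'' − (−1)^f` on `Z`, `S = σ·1_Z`: then `Σ_x (e − S)² ≤ 507`.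
Finite-slice statement, NOT summit progress. [this work] -/
theorem tzc_pi_sq_le (f g : (Fin (6 + 6) → Bool) → Bool) (hf : IsDegLeFun 3 f) (hg : IsDegLeFun 3 g)
    (u'' : (Fin (6 + 6) → Bool) → ℤ) (hu'' : ∀ x, W (fun y => signOf (g y)) x = (2 : ℝ) ^ 6 * (u'' x : ℝ))
    (V₀ : Finset (Fin (6 + 6) → Bool)) (xZ : Fin (6 + 6) → Bool) (h0 : zeroVec ∈ V₀)
    (hadd : ∀ a ∈ V₀, ∀ b ∈ V₀, bxor a b ∈ V₀) (hcardV : #V₀ = 512)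
    (hS : (univ.filter fun x : Fin (6 + 6) → Bool => ¬ Odd (u'' x)) = V₀.image (bxor xZ))
    (hlo : (57 / 64 : ℝ) < forrelation f g) :
    (∑ x, (u'' x - sZ (f x) - (if x ∈ (univ.filter fun x : Fin (6 + 6) → Bool => ¬ Odd (u'' x))
        then sZ (decide ((u'' x - sZ (f x)) % 4 = 3)) else 0)) ^ 2 : ℤ) ≤ 507 := by
  classical
  set Z := univ.filter (fun x : Fin (6 + 6) → Bool => ¬ Odd (u'' x)) with hZdef
  set e : (Fin (6 + 6) → Bool) → ℤ := fun x => u'' x - sZ (f x) with hedef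
  set hb : (Fin (6 + 6) → Bool) → Bool := fun x => decide (e x % 4 = 3) with hbdef
  show (∑ x, (e x - (if x ∈ Z then sZ (hb x) else 0)) ^ 2 : ℤ) ≤ 507
  have hZ : #Z = 512 := by rw [hS, card_image_of_injective _ (iw_bxor_injective xZ), hcardV]
  obtain ⟨hBR, heodd, hoffle⟩ := tzw_budget_split f g u'' hu''
  have hB : (∑ x, e x ^ 2 : ℤ) ≤ 895 := by
    have h' : ((∑ x, e x ^ 2 : ℤ) : ℝ) < 896 := by rw [hBR]; linarith
    have h'' : (∑ x, e x ^ 2 : ℤ) < 896 := by exact_mod_cast h'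
    omega
  rw [hZ] at hoffle
  have hoff : ∑ x ∈ univ.filter (fun x => x ∉ Z), e x ^ 2 ≤ 383 := by push_cast at hoffle; linarith
  have heodd' : ∀ x ∈ Z, Odd (e x) := fun x hx => heodd x hx
  have heeven : ∀ x, x ∉ Z → Even (e x) := fun x hx => gh_even_off f u'' x hx
  have hmod4 : ∀ x ∈ Z, (4 : ℤ) ∣ e x - sZ (hb x) := fun x hx => tza_mod4 f u'' hx
  -- the cost `c = e² − 1_Z`: `Σ c = B − 512 ≤ 380` (`4 ∣ Σ c`)
  set c : (Fin (6 + 6) → Bool) → ℤ := fun x => e x ^ 2 - (if x ∈ Z then 1 else 0) with hcdef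
  have hindZ : ∑ x, (if x ∈ Z then (1 : ℤ) else 0) = 512 := by
    rw [sum_boole]
    have : (univ.filter fun x => x ∈ Z) = Z := by ext x; simp
    rw [this, hZ]; norm_num
  have hcsum : ∑ x, c x = (∑ x, e x ^ 2) - 512 := by simp only [c]; rw [sum_sub_distrib, hindZ]
  have hc4 : ∀ x, (4 : ℤ) ∣ c x := by
    intro x
    by_cases hx : x ∈ Z
    · simp only [c]; rw [if_pos hx]
      obtain ⟨k, hk⟩ := heodd' x hx
      exact ⟨k * (k + 1), by rw [hk]; ring⟩
    · simp only [c]; rw [if_neg hx, sub_zero]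
      obtain ⟨k, hk⟩ := heeven x hx
      exact ⟨k * k, by rw [hk]; ring⟩
  have hcle : ∑ x, c x ≤ 380 := by
    obtain ⟨q, hq⟩ := dvd_sum fun x (_ : x ∈ (univ : Finset (Fin (6 + 6) → Bool))) => hc4 x
    have h383 : ∑ x, c x ≤ 383 := by rw [hcsum]; linarith
    omega
  have hcnn : ∀ x, 0 ≤ c x := by
    intro x
    by_cases hx : x ∈ Z
    · simp only [c]; rw [if_pos hx]
      have ho := Int.odd_iff.1 (heodd' x hx)
      have : e x ≤ -1 ∨ 1 ≤ e x := by omega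
      have := tp_sq_ge (k := 1) (by norm_num) this
      linarith
    · simp only [c]; rw [if_neg hx, sub_zero]; exact sq_nonneg _
  -- split `Σ c` and `Σ q` over `Z` and its complement
  set q : (Fin (6 + 6) → Bool) → ℤ := fun x => (e x - (if x ∈ Z then sZ (hb x) else 0)) ^ 2 with hqdef
  show ∑ x, q x ≤ 507
  have hsplit : ∀ F : (Fin (6 + 6) → Bool) → ℤ, ∑ x, F x = ∑ x ∈ Z, F x + ∑ x ∈ univ.filter (fun x => x ∉ Z), F x := by
    intro F
    rw [← sum_filter_add_sum_filter_not univ (fun x => x ∈ Z)]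
    congr 1
    exact sum_congr (by ext x; simp) fun _ _ => rfl
  have hqoff : ∀ x, x ∉ Z → q x = e x ^ 2 := fun x hx => by simp only [q]; rw [if_neg hx, sub_zero]
  have hcoff : ∀ x, x ∉ Z → c x = e x ^ 2 := fun x hx => by simp only [c]; rw [if_neg hx, sub_zero]
  have hqon : ∀ x ∈ Z, q x = (e x - sZ (hb x)) ^ 2 := fun x hx => by simp only [q]; rw [if_pos hx]
  have hcon : ∀ x ∈ Z, c x = e x ^ 2 - 1 := fun x hx => by simp only [c]; rw [if_pos hx]
  have hEoff : ∑ x ∈ univ.filter (fun x => x ∉ Z), q x = ∑ x ∈ univ.filter (fun x => x ∉ Z), e x ^ 2 :=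
    sum_congr rfl fun x hx => hqoff x (mem_filter.1 hx).2
  have hEoff' : ∑ x ∈ univ.filter (fun x => x ∉ Z), c x = ∑ x ∈ univ.filter (fun x => x ∉ Z), e x ^ 2 :=
    sum_congr rfl fun x hx => hcoff x (mem_filter.1 hx).2
  -- pointwise on `Z`: `q ≤ 2c`
  have hq2c : ∀ x ∈ Z, q x ≤ 2 * c x := fun x hx => by
    rw [hqon x hx, hcon x hx]; exact tzc_pw_two (tp_sZ_cases (hb x)) (hmod4 x hx)
  by_contra hbig
  push Not at hbig
  have h508 : 508 ≤ ∑ x, q x := by omega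
  rw [hsplit q, hEoff] at h508
  have hcZ : ∑ x ∈ Z, c x + ∑ x ∈ univ.filter (fun x => x ∉ Z), e x ^ 2 ≤ 380 := by rw [← hEoff', ← hsplit c]; exact hcle
  rcases tzc_A2_energy f g hf hg u'' hu'' V₀ xZ h0 hadd hcardV hS hoff with h4off | h256
  · -- `4 ∣ e` off `Z`: `#L = 0` or `≥ 64`
    rcases tzc_L_card f g hf hg u'' hu'' V₀ xZ h0 hadd hcardV hS hoff h4off with hL0 | hL64
    · -- `L = ∅`: `8 ∣ e − σ` on `Z`, so `3q ≤ 4c` on `Z`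
      have h8 : ∀ x ∈ Z, (8 : ℤ) ∣ e x - sZ (hb x) := by
        intro x hx
        have hne : ¬ Odd ((e x - sZ (hb x)) / 4) := by
          intro hodd
          have hmem : x ∈ Z.filter (fun x => Odd ((e x - sZ (hb x)) / 4)) := mem_filter.2 ⟨hx, hodd⟩
          rw [card_eq_zero] at hL0
          rw [hL0] at hmem
          exact notMem_empty _ hmem
        obtain ⟨k, hk⟩ := hmod4 x hx
        have hk4 : (e x - sZ (hb x)) / 4 = k := by rw [hk]; omega
        rw [hk4] at hne
        obtain ⟨m, hm⟩ := Int.not_odd_iff_even.1 hne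
        exact ⟨m, by rw [hk, hm]; ring⟩
      have hq3 : ∀ x ∈ Z, 3 * q x ≤ 4 * c x := fun x hx => by
        rw [hqon x hx, hcon x hx]; exact tzc_pw_three (tp_sZ_cases (hb x)) (h8 x hx)
      have hsumZ : 3 * ∑ x ∈ Z, q x ≤ 4 * ∑ x ∈ Z, c x := by
        rw [mul_sum, mul_sum]; exact sum_le_sum hq3
      have hEnn : 0 ≤ ∑ x ∈ univ.filter (fun x => x ∉ Z), e x ^ 2 := sum_nonneg fun _ _ => sq_nonneg _
      linarith
    · -- `#L ≥ 64`: each point of `L` costs `≥ 8`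
      set L := Z.filter (fun x => Odd ((e x - sZ (hb x)) / 4)) with hLdef
      have hLsub : L ⊆ Z := filter_subset _ _
      have hcostL : ∀ x ∈ L, (8 : ℤ) ≤ c x := by
        intro x hx
        have hx' := mem_filter.1 hx
        rw [hcon x hx'.1]
        exact tzc_pw_L (tp_sZ_cases (hb x)) (hmod4 x hx'.1) hx'.2
      have hcZge : (512 : ℤ) ≤ ∑ x ∈ Z, c x := by
        have h64 : (64 : ℤ) ≤ #L := by exact_mod_cast hL64
        calc (512 : ℤ) ≤ 8 * #L := by linarith
          _ = ∑ x ∈ L, (8 : ℤ) := by rw [sum_const, nsmul_eq_mul, mul_comm]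
          _ ≤ ∑ x ∈ L, c x := sum_le_sum hcostL
          _ ≤ ∑ x ∈ Z, c x := sum_le_sum_of_subset_of_nonneg hLsub fun x _ _ => hcnn x
      have hEnn : 0 ≤ ∑ x ∈ univ.filter (fun x => x ∉ Z), e x ^ 2 := sum_nonneg fun _ _ => sq_nonneg _
      linarith
  · -- `E_off ≥ 256`: then `Σ_Z c ≤ 124 < 128 ≤ Σ_Z (q − c) ≤ Σ_Z c`
    have hsumZ : ∑ x ∈ Z, q x ≤ 2 * ∑ x ∈ Z, c x := by
      rw [mul_sum]; exact sum_le_sum hq2c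
    have h256' : (256 : ℤ) ≤ ∑ x ∈ univ.filter (fun x => x ∉ Z), e x ^ 2 := h256
    linarith

end Summit.QuantumAdvantage.QuantumAdvantage.Theorems.CubicForrelation.NearExactIsExact

end
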